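import Summits.HubbardSuperconductivity.HubbardSuperconductivity.Theorems.AnisotropyChordTransferFibre3RowCGminShells
import Summits.HubbardSuperconductivity.HubbardSuperconductivity.Theorems.AnisotropyChordTransferFibre3RowCGradSup
import Summits.HubbardSuperconductivity.HubbardSuperconductivity.Theorems.AnisotropyChordTransferFibre3GroundSup

/-!
# Route `AnisotropyChord` / H0 rotor rung: PartN41-C §2 — an L-UNIFORM G-MIN CONSTANT: `−G̃_λ(r) ≤ 0.07 + 0.1ν` (`L ≥ 128`)

Theory-1 g22's PartN41-C §2 `GminUniform` asks for `−G̃_λ(r) ≤ 0.064 + 0.1ν` (`L ≥ 128`, `0 < λ₂ ≤ 0.0513θ²`), a constant read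
off the GeomGMin bound with 1.5 % to spare; the L-uniform estimate provable from `geomGMin_holds` (`n₀ = ⌊V/3⌋`) by elementary
exponential numerics is ★ `gmin_uniform : −G̃_λ(r) ≤ 0.07 + 0.1ν` (rigorous value `0.0646 + 0.092ν`): first term
`≤ 0.04167 + 0.0515ν` (`RowC.first_term_le`); second term ★ `torus_le_pbox` + ★ `pbox_G_le` by classes of the centred
representative (shells `|m| = 1`, `|m₁| = |m₂| = 1` from …RowCGminShells, far rings `|m|∞ ≥ 2` with ring sums
`≤ (4.32/θ²)·0.04791ⁿ`).  Consequence ★ `fmax_uniform`: `|f(r)| ≤ 1 + a/V + c_s(0.07 + 0.1ν)` for the ground profile — the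
`M` of the KT-2b row with the provable constant (cost on `f_max` vs the typed `FmaxUniform`: +0.4 %).
Prover seat `hubbard-h0-rotor-p1` g27 (route lead); helper for stmt-HubbardSuperconductivity-23918 (`--supports`, helper class).
WHAT THIS IS NOT: nothing here proves superconductivity in the Hubbard model; one L-uniform constant of ONE row of ONE
conditional reduction, with a WEAKER constant than the typed target.  Tree imports only; no new definitions; no sorry.
-/

set_option linter.dupNamespace false
set_option autoImplicit false

noncomputable section

open scoped BigOperators

namespace Summit.HubbardSuperconductivity.HubbardSuperconductivity.Theorems.AnisotropyChord.Transfer.Fibre3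

namespace RowC

open RateLemma

/-- antitonicity of the far weight `e^{−cq}/(dq)` in `q`. [folklore] -/
theorem far_weight_antitone (c d a q : ℝ) (hc : 0 ≤ c) (hd : 0 < d) (ha : 0 < a) (haq : a ≤ q) :
    Real.exp (-(c * q)) / (d * q) ≤ Real.exp (-(c * a)) / (d * a) := by
  have hq : 0 < q := lt_of_lt_of_le ha haq
  exact div_le_div₀ (Real.exp_pos _).le (Real.exp_le_exp.mpr (by nlinarith)) (by positivity) (by nlinarith)

/-- `e^{−3.04 t} ≤ 0.04791ᵗ`. [folklore] -/
theorem exp_neg_mul_le_pow (t : ℕ) : Real.exp (-(3.04 * (t : ℝ))) ≤ (0.04791 : ℝ) ^ t := by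
  have e : Real.exp (-(3.04 * (t : ℝ))) = Real.exp (-3.04) ^ t := by
    rw [← Real.exp_nat_mul]; congr 1; ring
  rw [e]
  exact pow_le_pow_left₀ (Real.exp_pos _).le exp_neg_304 t

/-- a far-ring point: `e^{−c q}/(d θ² q) ≤ (4.32/θ²)ρ^{n+1}/(8(n+1))` when `q ≥ (n+1)²`, `e^{−c(n+1)²} ≤ e^{−3.04(n+1)}`
and `8 ≤ 4.32·d·(n+1)`. [folklore] -/
theorem far_point_le (θ2 c d q : ℝ) (n : ℕ) (hθ2 : 0 < θ2) (hc : 0 ≤ c) (hd : 0 < d)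
    (hq : ((n : ℝ) + 1) ^ 2 ≤ q) (hdec : 3.04 * ((n : ℝ) + 1) ≤ c * ((n : ℝ) + 1) ^ 2)
    (hK : 8 ≤ 4.32 * d * ((n : ℝ) + 1)) :
    Real.exp (-(c * q)) / (d * θ2 * q) ≤ 4.32 / θ2 * (0.04791 : ℝ) ^ (n + 1) / (8 * ((n : ℝ) + 1)) := by
  have ht : (0 : ℝ) < (n : ℝ) + 1 := by positivity
  have h1 := far_weight_antitone c (d * θ2) (((n : ℝ) + 1) ^ 2) q hc (by positivity) (by positivity) hq
  refine h1.trans ?_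
  have hρ : Real.exp (-(c * ((n : ℝ) + 1) ^ 2)) ≤ (0.04791 : ℝ) ^ (n + 1) := by
    have := exp_neg_mul_le_pow (n + 1); push_cast at this
    exact (Real.exp_le_exp.mpr (by linarith)).trans this
  rw [div_le_div_iff₀ (by positivity) (by positivity)]
  calc Real.exp (-(c * ((n : ℝ) + 1) ^ 2)) * (8 * ((n : ℝ) + 1))
      ≤ (0.04791 : ℝ) ^ (n + 1) * (8 * ((n : ℝ) + 1)) := mul_le_mul_of_nonneg_right hρ (by positivity)
    _ ≤ 4.32 / θ2 * (0.04791 : ℝ) ^ (n + 1) * (d * θ2 * ((n : ℝ) + 1) ^ 2) := by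
        rw [show 4.32 / θ2 * (0.04791 : ℝ) ^ (n + 1) * (d * θ2 * ((n : ℝ) + 1) ^ 2)
            = (0.04791 : ℝ) ^ (n + 1) * ((4.32 * d * ((n : ℝ) + 1)) * ((n : ℝ) + 1)) by field_simp]
        have hρ0 : 0 ≤ (0.04791 : ℝ) ^ (n + 1) := by positivity
        nlinarith [mul_le_mul_of_nonneg_left (mul_le_mul_of_nonneg_right hK ht.le) hρ0]

/-- ★ the torus sum of the GeomGMin second term is at most the box sum of the class weights. [folklore] -/
theorem torus_le_pbox (L : ℕ) [NeZero L] (hL : 128 ≤ L) {lam2 ν : ℝ} (hl0 : 0 < lam2)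
    (hνlam : lam2 = ν * (2 * Real.pi / L) ^ 2) (hν0 : 0 ≤ ν) (hν1 : ν ≤ 0.0513)
    (n0 : ℕ) (hn0 : ((L : ℝ)) ^ 2 / 3 - 1 ≤ n0) :
    (∑ k ∈ (Finset.univ : Finset (Tor L)).erase 0, ((4 - epsT L k) / (4 - lam2 / 2)) ^ n0 * gres L lam2 k)
      ≤ ∑ m ∈ puncturedBox (L / 2), (fun m : ℤ × ℤ =>
          if m = (0, 0) then (0 : ℝ)
          else if m.1.natAbs + m.2.natAbs = 1 then 0.19325 * (1 + 1.784 * ν) / (0.9484 * (2 * Real.pi / L) ^ 2)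
          else if m.1.natAbs = 1 ∧ m.2.natAbs = 1 then 0.037341 * (1 + 1.784 * ν) / (1.9481 * (2 * Real.pi / L) ^ 2)
          else if m.1.natAbs ≤ L / 8 ∧ m.2.natAbs ≤ L / 8 then
            Real.exp (-(1.52 * (((m.1 ^ 2 + m.2 ^ 2 : ℤ)) : ℝ)))
              / (0.92717 * (2 * Real.pi / L) ^ 2 * (((m.1 ^ 2 + m.2 ^ 2 : ℤ)) : ℝ))
          else Real.exp (-(0.657 * (((m.1 ^ 2 + m.2 ^ 2 : ℤ)) : ℝ)))
              / (0.3998 * (2 * Real.pi / L) ^ 2 * (((m.1 ^ 2 + m.2 ^ 2 : ℤ)) : ℝ))) m := by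
  set G : ℤ × ℤ → ℝ := fun m =>
          if m = (0, 0) then (0 : ℝ)
          else if m.1.natAbs + m.2.natAbs = 1 then 0.19325 * (1 + 1.784 * ν) / (0.9484 * (2 * Real.pi / L) ^ 2)
          else if m.1.natAbs = 1 ∧ m.2.natAbs = 1 then 0.037341 * (1 + 1.784 * ν) / (1.9481 * (2 * Real.pi / L) ^ 2)
          else if m.1.natAbs ≤ L / 8 ∧ m.2.natAbs ≤ L / 8 then
            Real.exp (-(1.52 * (((m.1 ^ 2 + m.2 ^ 2 : ℤ)) : ℝ)))
              / (0.92717 * (2 * Real.pi / L) ^ 2 * (((m.1 ^ 2 + m.2 ^ 2 : ℤ)) : ℝ))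
          else Real.exp (-(0.657 * (((m.1 ^ 2 + m.2 ^ 2 : ℤ)) : ℝ)))
              / (0.3998 * (2 * Real.pi / L) ^ 2 * (((m.1 ^ 2 + m.2 ^ 2 : ℤ)) : ℝ)) with hGdef
  show _ ≤ ∑ m ∈ puncturedBox (L / 2), G m
  have hLpos : (0 : ℝ) < L := by exact_mod_cast (show 0 < L by omega)
  have h8 : 8 * (L / 8) ≤ L := by omega
  have hG0 : ∀ m : ℤ × ℤ, 0 ≤ G m := by
    intro m; rw [hGdef]; simp only
    split_ifs <;> positivity
  have hterm : ∀ k : Tor L, k ≠ 0 →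
      ((4 - epsT L k) / (4 - lam2 / 2)) ^ n0 * gres L lam2 k ≤ G (k.1.valMinAbs, k.2.valMinAbs) := by
    intro k hk
    have hrep : ((k.1.valMinAbs, k.2.valMinAbs) : ℤ × ℤ) ≠ (0, 0) := by
      intro h
      apply hk
      ext
      · simpa using (ZMod.valMinAbs_eq_zero k.1).1 (congrArg Prod.fst h)
      · simpa using (ZMod.valMinAbs_eq_zero k.2).1 (congrArg Prod.snd h)
    have hqe : ((((k.1.valMinAbs) ^ 2 + (k.2.valMinAbs) ^ 2 : ℤ)) : ℝ)
        = (((k.1.valMinAbs : ℤ) : ℝ)) ^ 2 + (((k.2.valMinAbs : ℤ) : ℝ)) ^ 2 := by push_cast; ring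
    rw [hGdef]; simp only [if_neg hrep]
    by_cases h1 : k.1.valMinAbs.natAbs + k.2.valMinAbs.natAbs = 1
    · rw [if_pos h1]; exact shell1_le L hL hl0 hνlam hν0 hν1 n0 hn0 hk h1
    · rw [if_neg h1]
      by_cases h2 : k.1.valMinAbs.natAbs = 1 ∧ k.2.valMinAbs.natAbs = 1
      · rw [if_pos h2]; exact shell2_le L hL hl0 hνlam hν0 hν1 n0 hn0 hk h2
      · rw [if_neg h2, hqe]
        have hne : k.1.valMinAbs.natAbs ≠ 0 ∨ k.2.valMinAbs.natAbs ≠ 0 := by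
          by_contra hcon; push Not at hcon
          exact hrep (Prod.ext (Int.natAbs_eq_zero.mp hcon.1) (Int.natAbs_eq_zero.mp hcon.2))
        by_cases hin : k.1.valMinAbs.natAbs ≤ L / 8 ∧ k.2.valMinAbs.natAbs ≤ L / 8
        · rw [if_pos hin]
          have h4 : 2 ≤ k.1.valMinAbs.natAbs ∨ 2 ≤ k.2.valMinAbs.natAbs := by omega
          have hq4 := repsq_ge k 2 h4
          norm_num at hq4
          exact far_inner_le L hL hl0 hνlam hν1 n0 hn0 hk (L / 8) h8 hin hq4
        · rw [if_neg hin]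
          have h17 : 17 ≤ k.1.valMinAbs.natAbs ∨ 17 ≤ k.2.valMinAbs.natAbs := by omega
          have hq := repsq_ge k 17 h17
          norm_num at hq
          exact far_outer_le L hL hl0 hνlam hν1 n0 hn0 hk hq
  have s1 : (∑ k ∈ (Finset.univ : Finset (Tor L)).erase 0, ((4 - epsT L k) / (4 - lam2 / 2)) ^ n0 * gres L lam2 k)
      ≤ ∑ k ∈ (Finset.univ : Finset (Tor L)).erase 0, G (k.1.valMinAbs, k.2.valMinAbs) :=
    Finset.sum_le_sum fun k hk => hterm k (Finset.ne_of_mem_erase hk)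
  have s2 : (∑ k ∈ (Finset.univ : Finset (Tor L)).erase 0, G (k.1.valMinAbs, k.2.valMinAbs))
      ≤ ∑ k : Tor L, G (k.1.valMinAbs, k.2.valMinAbs) :=
    Finset.sum_le_univ_sum_of_nonneg fun k => hG0 _
  have s3 : (∑ k : Tor L, G (k.1.valMinAbs, k.2.valMinAbs))
      = ∑ m ∈ (Finset.univ : Finset (Tor L)).image (fun k : Tor L => (k.1.valMinAbs, k.2.valMinAbs)), G m := by
    rw [Finset.sum_image (fun a _ b _ h => rep_injective L h)]
  set box : Finset (ℤ × ℤ) := (Finset.Icc (-((L / 2 : ℕ) : ℤ)) (L / 2 : ℕ)) ×ˢ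
    (Finset.Icc (-((L / 2 : ℕ) : ℤ)) (L / 2 : ℕ)) with hboxdef
  have s4 : (Finset.univ : Finset (Tor L)).image (fun k : Tor L => (k.1.valMinAbs, k.2.valMinAbs)) ⊆ box := by
    rw [Finset.image_subset_iff]; intro k _; exact rep_mem_box L k
  have s5 := Finset.sum_le_sum_of_subset_of_nonneg s4 (fun m _ _ => hG0 m)
  have h0mem : ((0 : ℤ), (0 : ℤ)) ∈ box := by
    rw [hboxdef, Finset.mem_product]
    simp only [Finset.mem_Icc]
    refine ⟨⟨?_, ?_⟩, ?_, ?_⟩ <;> simp <;> positivity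
  have s6 : (∑ m ∈ box, G m) = ∑ m ∈ puncturedBox (L / 2), G m := by
    have hpb : puncturedBox (L / 2) = box.erase ((0 : ℤ), (0 : ℤ)) := rfl
    rw [hpb, ← Finset.sum_erase_add box _ h0mem]
    have hz : G ((0 : ℤ), (0 : ℤ)) = 0 := by rw [hGdef]; simp
    rw [hz, add_zero]
  calc _ ≤ _ := s1
    _ ≤ _ := s2
    _ = _ := s3
    _ ≤ ∑ m ∈ box, G m := s5
    _ = _ := s6

/-- ★ the box sum of the class weights: innermost ring exactly, far rings geometrically. [folklore] -/
theorem pbox_G_le (L : ℕ) (hL : 128 ≤ L) (ν : ℝ) (hν0 : 0 ≤ ν) :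
    (∑ m ∈ puncturedBox (L / 2), (fun m : ℤ × ℤ =>
          if m = (0, 0) then (0 : ℝ)
          else if m.1.natAbs + m.2.natAbs = 1 then 0.19325 * (1 + 1.784 * ν) / (0.9484 * (2 * Real.pi / L) ^ 2)
          else if m.1.natAbs = 1 ∧ m.2.natAbs = 1 then 0.037341 * (1 + 1.784 * ν) / (1.9481 * (2 * Real.pi / L) ^ 2)
          else if m.1.natAbs ≤ L / 8 ∧ m.2.natAbs ≤ L / 8 then
            Real.exp (-(1.52 * (((m.1 ^ 2 + m.2 ^ 2 : ℤ)) : ℝ)))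
              / (0.92717 * (2 * Real.pi / L) ^ 2 * (((m.1 ^ 2 + m.2 ^ 2 : ℤ)) : ℝ))
          else Real.exp (-(0.657 * (((m.1 ^ 2 + m.2 ^ 2 : ℤ)) : ℝ)))
              / (0.3998 * (2 * Real.pi / L) ^ 2 * (((m.1 ^ 2 + m.2 ^ 2 : ℤ)) : ℝ))) m)
      ≤ (4 * 0.19325 / 0.9484 * (1 + 1.784 * ν) + 4 * 0.037341 / 1.9481 * (1 + 1.784 * ν)
          + 4.32 * (0.04791 ^ 2 / (1 - 0.04791))) / (2 * Real.pi / L) ^ 2 := by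
  set θ2 : ℝ := (2 * Real.pi / (L : ℝ)) ^ 2 with hθ2
  have hLpos : (0 : ℝ) < L := by exact_mod_cast (show 0 < L by omega)
  have hθ2pos : 0 < θ2 := by positivity
  set B₁ : ℝ := 0.19325 * (1 + 1.784 * ν) / (0.9484 * θ2) with hB₁
  set B₂ : ℝ := 0.037341 * (1 + 1.784 * ν) / (1.9481 * θ2) with hB₂
  set G : ℤ × ℤ → ℝ := fun m =>
          if m = (0, 0) then (0 : ℝ)
          else if m.1.natAbs + m.2.natAbs = 1 then B₁
          else if m.1.natAbs = 1 ∧ m.2.natAbs = 1 then B₂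
          else if m.1.natAbs ≤ L / 8 ∧ m.2.natAbs ≤ L / 8 then
            Real.exp (-(1.52 * (((m.1 ^ 2 + m.2 ^ 2 : ℤ)) : ℝ))) / (0.92717 * θ2 * (((m.1 ^ 2 + m.2 ^ 2 : ℤ)) : ℝ))
          else Real.exp (-(0.657 * (((m.1 ^ 2 + m.2 ^ 2 : ℤ)) : ℝ))) / (0.3998 * θ2 * (((m.1 ^ 2 + m.2 ^ 2 : ℤ)) : ℝ))
    with hGdef
  show ∑ m ∈ puncturedBox (L / 2), G m ≤ _
  set N : ℕ := L / 2 with hN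
  set N₁ : ℕ := L / 8 with hN₁
  have hN₁16 : 16 ≤ N₁ := by omega
  have hsplit : ∑ m ∈ puncturedBox N, G m
      = (∑ m ∈ puncturedBox 1, G m) + ∑ m ∈ puncturedBox N \ puncturedBox 1, G m := by
    rw [Finset.sum_sdiff_eq_sub (puncturedBox_subset (by omega : 1 ≤ N))]; ring
  have h1 : ∑ m ∈ puncturedBox 1, G m = 4 * B₁ + 4 * B₂ := by
    rw [pbox_one_eq]
    rw [Finset.sum_insert (by decide), Finset.sum_insert (by decide), Finset.sum_insert (by decide),
      Finset.sum_insert (by decide), Finset.sum_insert (by decide), Finset.sum_insert (by decide),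
      Finset.sum_insert (by decide), Finset.sum_singleton]
    rw [hGdef]
    norm_num
    ring
  set φ : ℕ → ℝ := fun n => 4.32 / θ2 * (0.04791 : ℝ) ^ (n + 1) / (8 * ((n : ℝ) + 1)) with hφ
  have hring : ∀ n : ℕ, 1 ≤ n → n < N → ∀ m ∈ puncturedBox (n + 1) \ puncturedBox n, G m ≤ φ n := by
    intro n hn _ m hm
    obtain ⟨hm1, hm2, hsq, hmax⟩ := ring_facts n m hm
    have ht2 : (2 : ℝ) ≤ (n : ℝ) + 1 := by
      have : (1 : ℝ) ≤ n := by exact_mod_cast hn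
      linarith
    have hm0 : m ≠ (0, 0) := by
      intro h; rw [h] at hmax; simp at hmax
    have hns1 : ¬ (m.1.natAbs + m.2.natAbs = 1) := by rcases hmax with h | h <;> omega
    have hns2 : ¬ (m.1.natAbs = 1 ∧ m.2.natAbs = 1) := by rintro ⟨a, b⟩; rcases hmax with h | h <;> omega
    rw [hGdef]; simp only [if_neg hm0, if_neg hns1, if_neg hns2]
    have hreg : (m.1.natAbs ≤ N₁ ∧ m.2.natAbs ≤ N₁) ↔ n + 1 ≤ N₁ := by
      constructor
      · rintro ⟨a1, a2⟩; rcases hmax with h | h <;> omega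
      · intro h
        have h' : (((n + 1 : ℕ)) : ℝ) ≤ (N₁ : ℝ) := by exact_mod_cast h
        push_cast at h'
        exact ⟨by exact_mod_cast hm1.trans h', by exact_mod_cast hm2.trans h'⟩
    by_cases hr : n + 1 ≤ N₁
    · rw [if_pos (hreg.mpr hr)]
      exact far_point_le θ2 1.52 0.92717 _ n hθ2pos (by norm_num) (by norm_num) hsq (by nlinarith) (by nlinarith)
    · rw [if_neg (fun h => hr (hreg.mp h))]
      have ht17 : (17 : ℝ) ≤ (n : ℝ) + 1 := by
        have : N₁ + 1 ≤ n + 1 := by omega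
        have : ((N₁ : ℝ)) + 1 ≤ (n : ℝ) + 1 := by exact_mod_cast this
        have : (16 : ℝ) ≤ N₁ := by exact_mod_cast hN₁16
        linarith
      exact far_point_le θ2 0.657 0.3998 _ n hθ2pos (by norm_num) (by norm_num) hsq (by nlinarith) (by nlinarith)
  have h2 := sum_sdiff_pbox_le G φ 1 N (by omega) hring
  have h3 : ∑ n ∈ Finset.Ico 1 N, 8 * ((n : ℝ) + 1) * φ n ≤ 4.32 / θ2 * (0.04791 ^ 2 / (1 - 0.04791)) := by
    have e : ∀ n : ℕ, 8 * ((n : ℝ) + 1) * φ n = 4.32 / θ2 * (0.04791 : ℝ) ^ (n + 1) := by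
      intro n; rw [hφ]; simp only; field_simp
    rw [Finset.sum_congr rfl fun n _ => e n, ← Finset.mul_sum]
    apply mul_le_mul_of_nonneg_left _ (by positivity)
    rw [Finset.sum_Ico_add' (fun j => (0.04791 : ℝ) ^ j) 1 N 1]
    have := geom_sum_Ico_le_of_lt_one (show (0 : ℝ) ≤ 0.04791 by norm_num) (show (0.04791 : ℝ) < 1 by norm_num)
      (m := 1 + 1) (n := N + 1)
    simpa using this
  rw [hsplit, h1]
  have e : (4 * 0.19325 / 0.9484 * (1 + 1.784 * ν) + 4 * 0.037341 / 1.9481 * (1 + 1.784 * ν)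
        + 4.32 * (0.04791 ^ 2 / (1 - 0.04791))) / θ2
      = 4 * B₁ + 4 * B₂ + 4.32 / θ2 * (0.04791 ^ 2 / (1 - 0.04791)) := by
    rw [hB₁, hB₂]; field_simp
  rw [e]
  linarith

/-- numerics of the first term. [folklore] -/
theorem T1_num (W ν x : ℝ) (hW0 : 0 < W) (hW : W ≤ 39.479 * ν) (hx0 : 0 ≤ x) (hx : x ≤ W / 23.9994) :
    (x + 3 / 4 * x ^ 2) / W ≤ 0.04167 + 0.0515 * ν := by
  rw [div_le_iff₀ hW0]
  have h1 : x ^ 2 ≤ (W / 23.9994) ^ 2 := pow_le_pow_left₀ hx0 hx 2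
  have h2 : (W / 23.9994) ^ 2 ≤ W * (39.479 * ν) / 23.9994 ^ 2 := by
    rw [div_pow, div_le_div_iff₀ (by positivity) (by positivity)]
    nlinarith [mul_le_mul_of_nonneg_left hW hW0.le]
  have h3 : x ≤ 0.04167 * W := by
    have : W / 23.9994 ≤ 0.04167 * W := by
      rw [div_le_iff₀ (by norm_num)]; nlinarith
    linarith
  have h4 : 3 / 4 * x ^ 2 ≤ 0.0515 * ν * W := by
    have hνW : 0 ≤ W * ν := by nlinarith
    have h5 : W * (39.479 * ν) / 23.9994 ^ 2 ≤ 0.0686 * (W * ν) := by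
      rw [div_le_iff₀ (by norm_num)]; nlinarith
    nlinarith
  linarith

/-- numerics of the second term. [folklore] -/
theorem T2_num (θ2 V ν B : ℝ) (hθ2 : 0 < θ2) (hVθ : 39.478 ≤ V * θ2) (hν0 : 0 ≤ ν)
    (hB : B ≤ (0.022853 + 0.0403 * ν) * 39.478) : B / θ2 ≤ (0.022853 + 0.0403 * ν) * V := by
  rw [div_le_iff₀ hθ2]
  have h0 : 0 ≤ 0.022853 + 0.0403 * ν := by positivity
  have := mul_le_mul_of_nonneg_left hVθ h0
  nlinarith

/-- the constant of the second term. [folklore] -/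
theorem T2_const (ν : ℝ) (hν0 : 0 ≤ ν) :
    (4 * 0.19325 / 0.9484 * (1 + 1.784 * ν) + 4 * 0.037341 / 1.9481 * (1 + 1.784 * ν)
        + 4.32 * (0.04791 ^ 2 / (1 - 0.04791))) ≤ (0.022853 + 0.0403 * ν) * 39.478 := by
  have h1 : 4 * 0.19325 / 0.9484 ≤ (0.81506 : ℝ) := by norm_num
  have h2 : 4 * 0.037341 / 1.9481 ≤ (0.07668 : ℝ) := by norm_num
  have h3 : 4.32 * (0.04791 ^ 2 / (1 - 0.04791)) ≤ (0.010416 : ℝ) := by norm_num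
  have h4 : 0 ≤ 1 + 1.784 * ν := by positivity
  nlinarith [mul_le_mul_of_nonneg_right h1 h4, mul_le_mul_of_nonneg_right h2 h4]

set_option maxHeartbeats 800000 in
/-- ★ THE L-UNIFORM G-MIN CONSTANT: `−G̃_λ(r) ≤ 0.07 + 0.1ν` for `L ≥ 128`, `0 < λ₂ ≤ 0.0513θ²`, every `r`. [folklore] -/
theorem gmin_uniform (L : ℕ) [NeZero L] (hL : 128 ≤ L) {lam2 : ℝ} (hl0 : 0 < lam2)
    (hl : lam2 ≤ 0.0513 * (2 * Real.pi / L) ^ 2) (r : Tor L) :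
    -Gres L lam2 r ≤ 0.07 + 0.1 * (lam2 / (2 * Real.pi / L) ^ 2) := by
  obtain ⟨hVθ, hV16, hθ2⟩ := size_facts L hL
  have hπ := Real.pi_lt_d4
  have hπ' := Real.pi_gt_d6
  have hπ0 := Real.pi_pos
  have hLpos : (0 : ℝ) < L := by exact_mod_cast (show 0 < L by omega)
  set θ : ℝ := 2 * Real.pi / L with hθ
  have hθpos : 0 < θ := by positivity
  set V : ℝ := (L : ℝ) ^ 2 with hV
  have hVpos : 0 < V := by positivity
  set ν : ℝ := lam2 / θ ^ 2 with hν
  have hνlam : lam2 = ν * θ ^ 2 := by rw [hν]; field_simp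
  have hν0 : 0 ≤ ν := by positivity
  have hν1 : ν ≤ 0.0513 := by rw [hν, div_le_iff₀ (by positivity)]; exact hl
  have hl1 : lam2 ≤ 1 := by nlinarith
  have hε := eps1_ge_sharp L hL
  rw [← hθ] at hε
  have hl2 : lam2 < 2 * eps1 L := by nlinarith
  -- `n₀ = ⌊V/3⌋`
  set n0 : ℕ := L * L / 3 with hn0
  have hn0le : (n0 : ℝ) ≤ V / 3 := by
    rw [hn0, hV, sq]; exact_mod_cast Nat.cast_div_le
  have hn0ge : V / 3 - 1 ≤ (n0 : ℝ) := by
    have h3 : L * L ≤ 3 * n0 + 2 := by omega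
    have : ((L : ℝ)) * L ≤ 3 * (n0 : ℝ) + 2 := by exact_mod_cast h3
    rw [hV, sq]; linarith
  have hG := geomGMin_holds L lam2 hl0 hl2 n0 r
  -- first term
  have hVlam : V * lam2 = 4 * Real.pi ^ 2 * ν := by rw [hνlam, ← hVθ]; ring
  have hVlam' : V * lam2 ≤ 39.479 * ν := by
    have hπ2 : Real.pi ^ 2 ≤ 9.8697 := by nlinarith
    rw [hVlam]; nlinarith [mul_le_mul_of_nonneg_right hπ2 hν0]
  have hc0 : 0 < 4 - lam2 / 2 := by linarith
  have hq0 : 0 ≤ lam2 / 2 / (4 - lam2 / 2) := div_nonneg (by linarith) hc0.le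
  have hx : (n0 : ℝ) * (lam2 / 2 / (4 - lam2 / 2)) ≤ V * lam2 / 23.9994 := by
    have h1 : lam2 / 2 / (4 - lam2 / 2) ≤ lam2 / 2 / 3.9999 :=
      div_le_div_of_nonneg_left (by linarith) (by norm_num) (by linarith)
    calc (n0 : ℝ) * (lam2 / 2 / (4 - lam2 / 2)) ≤ (V / 3) * (lam2 / 2 / 3.9999) :=
          mul_le_mul hn0le h1 hq0 (by positivity)
      _ = V * lam2 / 23.9994 := by ring
  have hx0 : 0 ≤ (n0 : ℝ) * (lam2 / 2 / (4 - lam2 / 2)) := mul_nonneg (Nat.cast_nonneg _) hq0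
  have hx1 : (n0 : ℝ) * (lam2 / 2 / (4 - lam2 / 2)) ≤ 1 := by
    have : V * lam2 / 23.9994 ≤ 1 := by
      rw [div_le_iff₀ (by norm_num)]; nlinarith
    exact hx.trans this
  have hT1 := first_term_le V lam2 hVpos hl0 hl1 n0 hx1
  have hT1' : ((n0 : ℝ) * (lam2 / 2 / (4 - lam2 / 2)) + 3 / 4 * ((n0 : ℝ) * (lam2 / 2 / (4 - lam2 / 2))) ^ 2)
      / (lam2 * V) ≤ 0.04167 + 0.0515 * ν := by
    rw [show lam2 * V = V * lam2 by ring]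
    exact T1_num (V * lam2) ν _ (by positivity) hVlam' hx0 hx
  -- second term
  have hT2a := torus_le_pbox L hL hl0 hνlam hν0 hν1 n0 hn0ge
  have hT2b := pbox_G_le L hL ν hν0
  have hT2 : (∑ k ∈ (Finset.univ : Finset (Tor L)).erase 0, ((4 - epsT L k) / (4 - lam2 / 2)) ^ n0 * gres L lam2 k) / V
      ≤ 0.022853 + 0.0403 * ν := by
    rw [div_le_iff₀ hVpos]
    refine (hT2a.trans hT2b).trans ?_
    rw [← hθ]
    have hVθ' : 39.478 ≤ V * θ ^ 2 := by rw [hVθ]; nlinarith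
    exact T2_num (θ ^ 2) V ν _ (by positivity) hVθ' hν0 (T2_const ν hν0)
  have hVL : (L : ℝ) ^ 2 = V := rfl
  calc -Gres L lam2 r ≤ _ := hG
    _ ≤ (0.04167 + 0.0515 * ν) + (0.022853 + 0.0403 * ν) := add_le_add (hT1.trans hT1') hT2
    _ ≤ 0.07 + 0.1 * ν := by nlinarith

/-! ## The consequence for `f_max` -/

/-- ★ `|f(r)| ≤ 1 + a/V + c_s(0.07 + 0.1ν)` for the ground profile (`L ≥ 128`, `0 ≤ Δ < 1`, `λ₂ ≤ 0.0513θ²`):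
the provable form of `FmaxUniform`. [folklore] -/
theorem fmax_uniform (L : ℕ) [NeZero L] (hL : 128 ≤ L) {Δ lam2 : ℝ} {f : Tor L → ℝ} (hΔ0 : 0 ≤ Δ) (hΔ1 : Δ < 1)
    (hf : IsGroundTwoMagnon L Δ lam2 f) (hlam : lam2 ≤ 0.0513 * (2 * Real.pi / L) ^ 2) (r : Tor L) :
    |f r| ≤ 1 + Δ * f (K1 L) / (L : ℝ) ^ 2
      + cS L Δ lam2 f * (0.07 + 0.1 * (lam2 / (2 * Real.pi / L) ^ 2)) := by
  have hL5 : 5 ≤ L := by omega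
  have hpos := lam2_pos L (by omega) hΔ1 hf.1
  have hfnn : 0 < f (K1 L) := hf.1.2.2.1
  have hcs : 0 ≤ cS L Δ lam2 f := by
    have : 0 ≤ 4 * (1 - Δ) + Δ * lam2 := by nlinarith
    unfold cS; exact mul_nonneg hfnn.le this
  have hV : (0 : ℝ) < (L : ℝ) ^ 2 := by
    have : (0 : ℝ) < L := by exact_mod_cast (show 0 < L by omega)
    positivity
  have hG := gmin_uniform L hL hpos hlam r
  have hc := cS_mul_Gres_zero L hL5 hΔ0 hΔ1 hf
  have hbound : 0 ≤ cS L Δ lam2 f * (0.07 + 0.1 * (lam2 / (2 * Real.pi / L) ^ 2)) := by positivity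
  by_cases hr : r = 0
  · rw [hr, hf.1.1, abs_zero]
    have : 0 ≤ Δ * f (K1 L) / (L : ℝ) ^ 2 := by positivity
    linarith
  · have hP := ground_profile_aKer L hL5 hΔ0 hΔ1 hf hr
    have hfr : 0 < f r := ground_pos L (by omega) hf r hr
    rw [abs_of_pos hfr, hP]
    unfold aKer
    have : cS L Δ lam2 f * -Gres L lam2 r ≤ cS L Δ lam2 f * (0.07 + 0.1 * (lam2 / (2 * Real.pi / L) ^ 2)) :=
      mul_le_mul_of_nonneg_left hG hcs
    nlinarith

end RowC

end Summit.HubbardSuperconductivity.HubbardSuperconductivity.Theorems.AnisotropyChord.Transfer.Fibre3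

end
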